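import Mathlib
import Literature.Analysis.FluidPDE.SelfSimilarEulerProfile
import Literature.Analysis.FluidPDE.SelfSimilarEulerOutgoingExclusionTools
import Literature.NumberTheory.LFunctions.NicolasMertensRHProofs
import Summits.NavierStokesRegularity.NavierStokesRegularity.Theorems.EulerZoomLiouvillePowerGaugeEulerLiouvilleChannelClockTools
import Summits.NavierStokesRegularity.NavierStokesRegularity.Theorems.EulerZoomLiouvillePowerGaugeEulerLiouvilleBandClockTools
import Summits.NavierStokesRegularity.NavierStokesRegularity.Theorems.EulerZoomLiouvillePowerGaugeEulerLiouvilleSelfSimilarVorticalEscape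
import Summits.NavierStokesRegularity.NavierStokesRegularity.Theorems.EulerZoomLiouvillePowerGaugeEulerLiouvilleOutflowDiveVorticityTransport
import HarnessLib

/-!
# «ONLY NEAR-CIRCULAR ORBITS SURVIVE», I (class-free): an INFLOW HALF-BAND DEFICIT of the radial acceleration is a LOG RESIDENCE CLOCK
# (crux `EulerZoomLiouville.PowerGaugeEulerLiouville` = stmt-NavierStokesRegularity-19832, THE ONE STATEMENT `stub_selfSimilarC2Needle`; new binder `HasInflowBandDeficit`)

Route `EulerZoomLiouville` (NavierStokesRegularity), crux E, LEAD seat ns-typeII-p2 g13 (own brick, sequel of `…ChannelClock` «any fast channel kills»).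
Let `(V, P′)` be a classical self-similar Euler profile about `0` at the class rate `γ = 1/(2+ρ)`, `ρ ∈ (0, ½]`, `W y = γy + V y`, `ℋ` its Bernoulli function,
`ℛ(y) = ⟪y, W y⟫` the RADIAL RATE and `a(y) = ‖W y‖² + γ⟪y, W y⟫ + ⟪y, DV(y)(W y)⟫ = Dℛ(y)[W y]` the forward RADIAL ACCELERATION of the similarity flow
(by the profile equation (3.3), `a = 2ℋ + 2γ(1−γ)‖y‖² − (1−2γ)ℛ − (2P′ + y·∇P′)`).  INFLOW HALF-BAND DEFICIT at rate `c₁ > 0` with margin `μ > 0` (for this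
pressure): for every level `h` there is `R₀` beyond which every VORTICAL point of `{ℋ > h}` whose radial rate lies in the inflow half-band
`−c₁‖y‖² ≤ ℛ(y) ≤ 0` has `a(y) ≥ (2c₁² + μ)‖y‖²` (it is a PERIGEE-type point: along the flow the normalised rate `λ = ℛ/‖y‖²` crosses the band
monotonically, `λ̇ = a/‖y‖² − 2λ² ≥ μ`).  This CONTAINS the one-sided channel `HasFastVorticalChannel` (rate `2c₁`: the half-band is empty).

* `BandClock.logClock_of_bandDeficit` — the deficit yields VERBATIM the `hclock` hypothesis of `NeedleRace.selfSimilar_ae_eq_zero_of_logClockC2`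
  (`Birth.HasResidenceClock` alternative 1) with `s₁ = 1/c₁ + 2`.

Mechanism: as in `ChannelClock.logClock_of_channel` (W3b null confined set ⇒ the near sojourn is `≤ n₀` for half the blob; first hit of `‖·‖ = R_* ≥ 2R₁` at
`σ₁ ≤ n₀` by the cut-off orbit, ODE uniqueness; the arc stays Bernoulli-high by (3.31) and vortical by `OutflowDive.vorticityTransport`), then: at the first
hit the radial rate is `≤ 0` (else `‖Y‖²` was larger just before); PHASE 1 (`BandClock.band_bootstrap` with slope `μ/2` on `[σ₁, σ₁ + 2c₁/μ]`): the rate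
sinks below `−c₁‖Y‖²` while the radius does not decrease; PHASE 2 (slope `0` on `[σ₁ + 2c₁/μ, T_R]`): it never returns to the band; Grönwall
(`BackwardEscape.norm_ge_mul_exp_of_fastInflow`) puts the label beyond `2R` before `T_R = (1/c₁ + 2) log R`.
Residue for THE ONE STATEMENT once the member lands (sequel `…BandClockMember`): for all small `c₁, μ` the needle has, beyond every radius, vortical
Bernoulli-high NEAR-CIRCULAR INFLOW points (`−c₁‖y‖² ≤ ℛ ≤ 0`) with SUB-THRESHOLD radial acceleration `a < (2c₁²+μ)‖y‖²`, i.e. VIRIAL-SUPPORTED: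
`2P′ + y·∇P′ > 2h + (2γ(1−γ) − 2c₁² − μ)‖y‖²`.

WHAT THIS IS NOT: not NS, not E — a class-free ODE/measure lemma about `C²` profiles (no budgets), `--supports` stmt-19832; the crux is OPEN;
NS regularity is NOT proved. [folklore; cf. ConstantinIgnatovaVicol2026Putative §3.4 (3.19)–(3.22), §3.4.3 (3.31)]
-/

noncomputable section

-- flat `Theorems/<Route><Decl>…` files of one crux share the namespace of the crux (tree convention: `Summit.<S>.<S>.…`)
set_option linter.dupNamespace false

open Set Filter Topology Metric MeasureTheory
open scoped RealInnerProductSpace ENNReal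

namespace Summit.NavierStokesRegularity.NavierStokesRegularity.Theorems.PowerGaugeEulerLiouville

open Literature.Analysis Literature.Analysis.FluidPDE

namespace BandClock

open ChannelClock

/-- **«ONLY NEAR-CIRCULAR ORBITS SURVIVE», class-free core: an inflow half-band deficit of the radial acceleration at rate `c₁ > 0`, margin `μ > 0`, is a
LOG RESIDENCE CLOCK with `s₁ = 1/c₁ + 2`** (see the module docstring; conclusion = the `hclock` hypothesis of `NeedleRace.selfSimilar_ae_eq_zero_of_logClockC2`).
[folklore; cf. ConstantinIgnatovaVicol2026Putative §3.4–§3.5] -/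
theorem logClock_of_bandDeficit {ρ : ℝ} (hρ : 0 < ρ) (hρh : ρ ≤ 1 / 2)
    {V : EuclideanSpace ℝ (Fin 3) → EuclideanSpace ℝ (Fin 3)} {P' : EuclideanSpace ℝ (Fin 3) → ℝ}
    (hprof : IsSelfSimilarEulerProfile (1 / (2 + ρ)) 0 V P') {c₁ μ : ℝ} (hc₁ : 0 < c₁) (hμ : 0 < μ)
    (hdef : ∀ h : ℝ, ∃ R₀ : ℝ, ∀ y : EuclideanSpace ℝ (Fin 3), R₀ ≤ ‖y‖ →
      h < selfSimilarBernoulli (1 / (2 + ρ)) 0 V P' y → curl V y ≠ 0 →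
        -(c₁ * ‖y‖ ^ 2) ≤ ⟪y, selfSimilarTransport (1 / (2 + ρ)) 0 V y⟫ → ⟪y, selfSimilarTransport (1 / (2 + ρ)) 0 V y⟫ ≤ 0 →
        (2 * c₁ ^ 2 + μ) * ‖y‖ ^ 2 ≤ ‖selfSimilarTransport (1 / (2 + ρ)) 0 V y‖ ^ 2 +
          (1 / (2 + ρ)) * ⟪y, selfSimilarTransport (1 / (2 + ρ)) 0 V y⟫ +
          ⟪y, fderiv ℝ V y (selfSimilarTransport (1 / (2 + ρ)) 0 V y)⟫) :
    ∀ x₀ : EuclideanSpace ℝ (Fin 3), curl V x₀ ≠ 0 → ∃ r : ℝ, 0 < r ∧ ∃ R₀ : ℝ, ∀ R : ℝ, R₀ ≤ R →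
      ∀ (V' : EuclideanSpace ℝ (Fin 3) → EuclideanSpace ℝ (Fin 3)) (K Rbig : ℝ), ContDiff ℝ 2 V' →
        (∀ y, ‖fderiv ℝ V' y‖ ≤ K) → 2 * R < Rbig →
        (∀ w ∈ ball (0 : EuclideanSpace ℝ (Fin 3)) Rbig, V' w = V w) →
        (volume (ball x₀ r ∩ {y | ∀ σ ∈ Icc 0 ((1 / c₁ + 2) * Real.log R),
          ‖ODE.evolutionMap (fun _ : ℝ => selfSimilarTransport (1 / (2 + ρ)) 0 V') 0 (-σ) y‖ ≤ 2 * R})).toReal ≤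
          (volume (ball x₀ r)).toReal / 2 := by
  intro x₀ hx₀
  set γ : ℝ := 1 / (2 + ρ) with hγdef
  have h2ρ : (0 : ℝ) < 2 + ρ := by linarith
  have hγ : 0 < γ := one_div_pos.2 h2ρ
  have hγ2 : γ < 1 / 2 := one_div_lt_one_div_of_lt two_pos (by linarith)
  have hU2 : ContDiff ℝ 2 V := hprof.contDiff_velocity
  -- ### the blob: a small ball inside `{ℋ > h} ∩ {curl ≠ 0}`, `h = ℋ(x₀) − 1`
  set h : ℝ := selfSimilarBernoulli γ 0 V P' x₀ - 1 with hhdef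
  have hHc : Continuous (selfSimilarBernoulli γ 0 V P') := hprof.contDiff_selfSimilarBernoulli.continuous
  have hcurlc : Continuous (curl V) := (differentiable_curl_of_contDiff hU2).continuous
  have hOopen : IsOpen {y : EuclideanSpace ℝ (Fin 3) | h < selfSimilarBernoulli γ 0 V P' y ∧ curl V y ≠ 0} := by
    rw [setOf_and]
    exact (isOpen_lt continuous_const hHc).inter (isOpen_ne_fun hcurlc continuous_const)
  have hx₀O : x₀ ∈ {y : EuclideanSpace ℝ (Fin 3) | h < selfSimilarBernoulli γ 0 V P' y ∧ curl V y ≠ 0} :=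
    ⟨by rw [hhdef]; linarith, hx₀⟩
  obtain ⟨r₀, hr₀, hball₀⟩ := Metric.isOpen_iff.1 hOopen x₀ hx₀O
  set r : ℝ := min r₀ 1 with hrdef
  have hr : 0 < r := lt_min hr₀ one_pos
  have hr1 : r ≤ 1 := min_le_right _ _
  have hballO : ∀ y ∈ ball x₀ r, h < selfSimilarBernoulli γ 0 V P' y ∧ curl V y ≠ 0 :=
    fun y hy => hball₀ (ball_subset_ball (min_le_left _ _) hy)
  -- ### the far threshold `R₁` of the channel at level `h`, and the hitting radius `R_* ≥ 2R₁`
  obtain ⟨R₁', hR₁'⟩ := hdef h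
  set R₁ : ℝ := max R₁' 1 with hR₁def
  have hR₁pos : 0 < R₁ := lt_of_lt_of_le one_pos (le_max_right _ _)
  have hfar : ∀ y : EuclideanSpace ℝ (Fin 3), R₁ ≤ ‖y‖ → h < selfSimilarBernoulli γ 0 V P' y → curl V y ≠ 0 →
      -(c₁ * ‖y‖ ^ 2) ≤ ⟪y, selfSimilarTransport γ 0 V y⟫ → ⟪y, selfSimilarTransport γ 0 V y⟫ ≤ 0 →
      (2 * c₁ ^ 2 + μ) * ‖y‖ ^ 2 ≤ ‖selfSimilarTransport γ 0 V y‖ ^ 2 + γ * ⟪y, selfSimilarTransport γ 0 V y⟫ +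
        ⟪y, fderiv ℝ V y (selfSimilarTransport γ 0 V y)⟫ :=
    fun y hy hh hc hlo hhi => hR₁' y (le_trans (le_max_left _ _) hy) hh hc hlo hhi
  -- the band transit time
  set τ : ℝ := 2 * c₁ / μ with hτdef
  have hτpos : 0 < τ := by positivity
  set Rs : ℝ := max (2 * R₁) (‖x₀‖ + 2) with hRsdef
  have hRs2R₁ : 2 * R₁ ≤ Rs := le_max_left _ _
  have hR₁1 : 1 ≤ R₁ := le_max_right _ _
  have hRs1 : 1 ≤ Rs := le_trans (by linarith) hRs2R₁
  have hRspos : 0 < Rs := by linarith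
  have hballRs : ∀ y ∈ ball x₀ r, ‖y‖ < Rs - 1 := by
    intro y hy
    have h1 : dist y x₀ < r := mem_ball.1 hy
    have h2 : ‖y‖ ≤ dist y x₀ + ‖x₀‖ := by
      have := dist_triangle y x₀ 0
      rwa [dist_zero_right, dist_zero_right] at this
    linarith [le_max_right (2 * R₁) (‖x₀‖ + 2)]
  -- ### the R-independent cut-off orbit and the near-confinement sets
  obtain ⟨V₀, hV₀, -, -, ⟨K₀, hK₀⟩, hagree₀⟩ := Loc.exists_cutoff_local hU2 (R := Rs + 1) (by linarith)
  have hV₀1 : ContDiff ℝ 1 V₀ := hV₀.of_le (by norm_num)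
  have hW₀eq : ∀ z : EuclideanSpace ℝ (Fin 3), ‖z‖ < Rs + 1 → selfSimilarTransport γ 0 V₀ z = selfSimilarTransport γ 0 V z := by
    intro z hz
    simp only [selfSimilarTransport_apply, hagree₀ z (by rwa [mem_ball, dist_zero_right])]
  set Φ₀ := ODE.evolutionMap (fun _ : ℝ => selfSimilarTransport γ 0 V₀) 0 with hΦ₀
  set Sn : ℕ → Set (EuclideanSpace ℝ (Fin 3)) := fun n =>
    ball x₀ r ∩ {y | ∀ σ ∈ Icc (0 : ℝ) n, ‖Φ₀ (-σ) y‖ ≤ Rs} with hSndef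
  have hSn_meas : ∀ n, MeasurableSet (Sn n) := by
    intro n
    refine measurableSet_ball.inter (IsClosed.measurableSet ?_)
    have : {y : EuclideanSpace ℝ (Fin 3) | ∀ σ ∈ Icc (0 : ℝ) n, ‖Φ₀ (-σ) y‖ ≤ Rs} =
        ⋂ σ ∈ Icc (0 : ℝ) n, {y | ‖Φ₀ (-σ) y‖ ≤ Rs} := by ext y; simp
    rw [this]
    refine isClosed_biInter fun σ _ => ?_
    exact isClosed_le ((C2.Kelvin.contDiff_flow (γ := γ) hV₀ hK₀ (-σ)).continuous.norm) continuous_const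
  have hSn_anti : Antitone Sn := by
    intro m n hmn y hy
    refine ⟨hy.1, fun σ hσ => hy.2 σ ⟨hσ.1, le_trans hσ.2 (by exact_mod_cast hmn)⟩⟩
  -- the intersection is inside the confined vortical set, null by W3b
  have hInter_null : volume (⋂ n, Sn n) = 0 := by
    refine measure_mono_null ?_ (Loc.volume_vortical_confined_eq_zero hprof hγ hγ2 hRspos)
    intro y hy
    rw [mem_iInter] at hy
    have hy0 : y ∈ ball x₀ r := (hy 0).1
    refine ⟨(hballO y hy0).2, fun t => Φ₀ (-t) y, by simp [hΦ₀, ODE.evolutionMap_self], ?_, ?_⟩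
    · intro t ht
      have hconf : ‖Φ₀ (-t) y‖ ≤ Rs := by
        obtain ⟨n, hn⟩ := exists_nat_ge t
        exact (hy n).2 t ⟨ht, hn⟩
      have hd := C2.Kelvin.hasDerivAt_flow_neg (γ := γ) hV₀1 hK₀ y t
      rw [hW₀eq _ (by linarith)] at hd
      exact hd
    · intro t ht
      obtain ⟨n, hn⟩ := exists_nat_ge t
      exact (hy n).2 t ⟨ht, hn⟩
  have htend : Tendsto (volume ∘ Sn) atTop (𝓝 0) := by
    rw [← hInter_null]
    exact tendsto_measure_iInter_atTop (fun n => (hSn_meas n).nullMeasurableSet) hSn_anti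
      ⟨0, (measure_mono inter_subset_left).trans_lt measure_ball_lt_top |>.ne⟩
  -- choose `n₀` with `volume (Sn n₀) ≤ volume (ball x₀ r) / 2`
  have hvpos : 0 < volume (ball x₀ r) := measure_ball_pos volume x₀ hr
  have hvtop : volume (ball x₀ r) < ∞ := measure_ball_lt_top
  have hhalf_pos : (0 : ℝ≥0∞) < volume (ball x₀ r) / 2 := ENNReal.half_pos hvpos.ne'
  obtain ⟨n₀, hn₀⟩ := (htend.eventually (ge_mem_nhds hhalf_pos)).exists
  -- ### the clock radius
  set T₀ : ℝ := (n₀ : ℝ) + τ + Real.log 2 / c₁ + 1 with hT₀def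
  refine ⟨r, hr, max Rs (Real.exp T₀), fun R hR V' K Rbig hV' hK' hRbig hagree' => ?_⟩
  have hRRs : Rs ≤ R := le_trans (le_max_left _ _) hR
  have hR1 : 1 ≤ R := le_trans hRs1 hRRs
  have hRpos : 0 < R := by linarith
  have hlogR : T₀ ≤ Real.log R := by
    have := le_trans (le_max_right _ _) hR
    calc T₀ = Real.log (Real.exp T₀) := (Real.log_exp T₀).symm
      _ ≤ Real.log R := Real.log_le_log (Real.exp_pos _) this
  have hlog2 : 0 < Real.log 2 := Real.log_pos one_lt_two
  have hn₀_nonneg : (0 : ℝ) ≤ n₀ := Nat.cast_nonneg n₀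
  set TR : ℝ := (1 / c₁ + 2) * Real.log R with hTRdef
  have hlogR0 : 0 ≤ Real.log R := Real.log_nonneg hR1
  have hTR_ge : (n₀ : ℝ) + τ + (Real.log R + Real.log 2) / c₁ + 1 ≤ TR := by
    rw [hTRdef]
    have e : (1 / c₁ + 2) * Real.log R = Real.log R / c₁ + 2 * Real.log R := by ring
    rw [e, add_div]
    linarith
  -- ### the main inclusion: lingering labels lie in `Sn n₀`
  have hV'1 : ContDiff ℝ 1 V' := hV'.of_le (by norm_num)
  have hW'eq : ∀ z : EuclideanSpace ℝ (Fin 3), ‖z‖ < Rbig → selfSimilarTransport γ 0 V' z = selfSimilarTransport γ 0 V z := by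
    intro z hz
    simp only [selfSimilarTransport_apply, hagree' z (by rwa [mem_ball, dist_zero_right])]
  set Φ' := ODE.evolutionMap (fun _ : ℝ => selfSimilarTransport γ 0 V') 0 with hΦ'
  have hincl : ball x₀ r ∩ {y | ∀ σ ∈ Icc 0 TR, ‖Φ' (-σ) y‖ ≤ 2 * R} ⊆ Sn n₀ := by
    rintro y ⟨hyB, hling⟩
    refine ⟨hyB, ?_⟩
    rw [mem_setOf_eq]
    by_contra hnot
    push Not at hnot
    obtain ⟨σ₀, hσ₀, hfar₀⟩ := hnot
    -- the two orbits
    set Y : ℝ → EuclideanSpace ℝ (Fin 3) := fun t => Φ' (-t) y with hYdef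
    set Y₀ : ℝ → EuclideanSpace ℝ (Fin 3) := fun t => Φ₀ (-t) y with hY₀def
    have hYd : ∀ t, HasDerivAt Y ((-1 : ℝ) • selfSimilarTransport γ 0 V' (Y t)) t :=
      fun t => C2.Kelvin.hasDerivAt_flow_neg (γ := γ) hV'1 hK' y t
    have hY₀d : ∀ t, HasDerivAt Y₀ ((-1 : ℝ) • selfSimilarTransport γ 0 V₀ (Y₀ t)) t :=
      fun t => C2.Kelvin.hasDerivAt_flow_neg (γ := γ) hV₀1 hK₀ y t
    have hYc : Continuous Y := continuous_iff_continuousAt.2 fun t => (hYd t).continuousAt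
    have hY₀c : Continuous Y₀ := continuous_iff_continuousAt.2 fun t => (hY₀d t).continuousAt
    have hY0 : Y 0 = y := by simp [hYdef, hΦ', ODE.evolutionMap_self]
    have hY₀0 : Y₀ 0 = y := by simp [hY₀def, hΦ₀, ODE.evolutionMap_self]
    -- first hit of the sphere `‖·‖ = Rs` by the cut-off orbit, at a time `σ₁ ∈ (0, σ₀]`
    have hy_lt : ‖Y₀ 0‖ < Rs := by rw [hY₀0]; linarith [hballRs y hyB]
    obtain ⟨σ₁, hσ₁pos, hσ₁le, hhit, hinside⟩ :=
      exists_first_hit (f := fun t => ‖Y₀ t‖) hσ₀.1 (hY₀c.norm.continuousOn) hy_lt hfar₀.le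
    have hσ₁n₀ : σ₁ ≤ n₀ := le_trans hσ₁le hσ₀.2
    -- on `[0, σ₁]` the cut-off orbit is a `V'`-orbit; by uniqueness `Y = Y₀` there
    have hRs_lt_Rbig : Rs + 1 ≤ Rbig := by linarith
    have hY₀V' : ∀ t ∈ Icc 0 σ₁, HasDerivAt Y₀ ((-1 : ℝ) • selfSimilarTransport γ 0 V' (Y₀ t)) t := by
      intro t ht
      have hn : ‖Y₀ t‖ ≤ Rs := hinside t ht
      have hd := hY₀d t
      rw [hW₀eq _ (by linarith), ← hW'eq _ (by linarith)] at hd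
      exact hd
    have hL' := C2.Kelvin.lipschitzWith_selfSimilarTransport (γ := γ) hV'1 hK'
    have hLneg : LipschitzWith (Real.toNNReal (|γ| + K)) (fun z => (-1 : ℝ) • selfSimilarTransport γ 0 V' z) :=
      LipschitzWith.of_dist_le_mul fun a b => by
        rw [neg_one_smul, neg_one_smul, dist_neg_neg]
        exact hL'.dist_le_mul a b
    have hEq : EqOn Y₀ Y (Icc 0 σ₁) :=
      ODE_solution_unique (v := fun _ z => (-1 : ℝ) • selfSimilarTransport γ 0 V' z)
        (fun _ => hLneg)
        (hY₀c.continuousOn) (fun t ht => (hY₀V' t (Ico_subset_Icc_self ht)).hasDerivWithinAt)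
        (hYc.continuousOn) (fun t _ => (hYd t).hasDerivWithinAt) (by rw [hY₀0, hY0])
    have hYσ₁ : ‖Y σ₁‖ = Rs := by
      rw [← hEq (right_mem_Icc.2 hσ₁pos.le)]; exact hhit
    -- on `[0, TR]` the `V'`-orbit stays in `B̄(0,2R) ⊆ ball 0 Rbig`: it is a `V`-arc there
    have hTR0 : 0 ≤ TR := by rw [hTRdef]; positivity
    have hστTR : σ₁ + τ ≤ TR := by
      have : 0 ≤ (Real.log R + Real.log 2) / c₁ := by positivity
      linarith [hTR_ge]
    have hσ₁TR : σ₁ ≤ TR := by linarith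
    have hYV : ∀ t ∈ Icc 0 TR, HasDerivAt Y (-(selfSimilarTransport γ 0 V (Y t))) t := by
      intro t ht
      have hn : ‖Y t‖ ≤ 2 * R := hling t ht
      have hd := hYd t
      rw [neg_one_smul, hW'eq _ (by linarith)] at hd
      exact hd
    -- Bernoulli-high and vortical along the whole arc
    have hhighY : ∀ t ∈ Icc 0 TR, h < selfSimilarBernoulli γ 0 V P' (Y t) := by
      intro t ht
      have hmono := bernoulli_le_of_arc hprof hγ2.le ht.1 (fun s hs => hYV s ⟨hs.1, le_trans hs.2 ht.2⟩)
      rw [hY0] at hmono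
      exact lt_of_lt_of_le (hballO y hyB).1 hmono
    have hvortY : ∀ t ∈ Icc 0 TR, curl V (Y t) ≠ 0 := by
      intro t ht
      have h0 : curl V (Y 0) ≠ 0 := by rw [hY0]; exact (hballO y hyB).2
      exact OutflowDive.vorticityTransport ρ hρ hρh V P' hprof t ht.1 Y
        (fun s hs => hYV s ⟨hs.1, le_trans hs.2 ht.2⟩) h0
    -- ### the radial rate at the first hit is `≤ 0`
    have hV1 : ContDiff ℝ 1 V := hU2.of_le (by norm_num)
    have hrate₁ : ⟪Y σ₁, selfSimilarTransport γ 0 V (Y σ₁)⟫ ≤ 0 := by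
      by_contra hpos
      push Not at hpos
      -- `N = ‖Y‖²` has derivative `−2ℛ < 0` at `σ₁`, so it was larger just before: contradiction with `‖Y‖ ≤ Rs` on `[0, σ₁]`
      have hNd : HasDerivAt (fun s => ‖Y s‖ ^ 2) (2 * ⟪Y σ₁, -(selfSimilarTransport γ 0 V (Y σ₁))⟫) σ₁ :=
        (hYV σ₁ ⟨hσ₁pos.le, hσ₁TR⟩).norm_sq
      have hneg : 2 * ⟪Y σ₁, -(selfSimilarTransport γ 0 V (Y σ₁))⟫ < 0 := by
        rw [inner_neg_right]; linarith
      have hev := Literature.NumberTheory.LFunctions.Nicolas.eventually_nhdsLT_lt_of_hasDerivAt_neg hNd hneg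
      have hev2 : ∀ᶠ z in 𝓝[<] σ₁, 0 ≤ z := Filter.eventually_of_mem (Ioo_mem_nhdsLT hσ₁pos) fun z hz => hz.1.le
      obtain ⟨z, ⟨hz, hz0⟩, hzlt⟩ := ((hev.and hev2).and self_mem_nhdsWithin).exists
      have hzle : ‖Y z‖ ≤ Rs := by
        rw [← hEq ⟨hz0, (le_of_lt hzlt)⟩]; exact hinside z ⟨hz0, le_of_lt hzlt⟩
      have h1 : ‖Y z‖ ^ 2 ≤ Rs ^ 2 := pow_le_pow_left₀ (norm_nonneg _) hzle 2
      rw [hYσ₁] at hz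
      linarith
    -- ### phase 1: crossing the band on `[σ₁, σ₁ + τ]` — the radial rate sinks to `≤ −c₁`
    have hsub1 : Icc σ₁ (σ₁ + τ) ⊆ Icc 0 TR := fun s hs => ⟨le_trans hσ₁pos.le hs.1, le_trans hs.2 hστTR⟩
    have hphase1 := BandClock.band_bootstrap (γ := γ) (P' := P') hV1 (c₁ := c₁) (μ := μ) (R₁ := R₁) (h := h)
      (t₀ := σ₁) (t₁ := σ₁ + τ) (m₀ := 0) (κ := μ / 2) hc₁ hR₁pos (by linarith) le_rfl (by positivity) (by linarith)
      (by rw [hτdef]; field_simp; ring_nf; exact le_rfl) hfar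
      (fun s hs => hYV s (hsub1 hs)) (fun s hs => hhighY s (hsub1 hs)) (fun s hs => hvortY s (hsub1 hs))
      (by rw [hYσ₁]; exact hRs2R₁) (by rw [zero_mul, add_zero]; exact hrate₁)
    have hend1 := hphase1 (σ₁ + τ) (right_mem_Icc.2 (by linarith))
    have hrate₂ : ⟪Y (σ₁ + τ), selfSimilarTransport γ 0 V (Y (σ₁ + τ))⟫ + c₁ * ‖Y (σ₁ + τ)‖ ^ 2 ≤ 0 := by
      have e : (0 : ℝ) + μ / 2 * (σ₁ + τ - σ₁) = c₁ := by rw [hτdef]; field_simp; ring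
      have := hend1.2
      rwa [e] at this
    have hrad₂ : 2 * R₁ ≤ ‖Y (σ₁ + τ)‖ := by
      have := hend1.1; rw [hYσ₁] at this; exact le_trans hRs2R₁ this
    -- ### phase 2: beyond the band forever on `[σ₁ + τ, TR]`
    have hsub2 : Icc (σ₁ + τ) TR ⊆ Icc 0 TR := fun s hs => ⟨by linarith [hs.1, hσ₁pos.le, hτpos.le], hs.2⟩
    have hphase2 := BandClock.band_bootstrap (γ := γ) (P' := P') hV1 (c₁ := c₁) (μ := μ) (R₁ := R₁) (h := h)
      (t₀ := σ₁ + τ) (t₁ := TR) (m₀ := c₁) (κ := 0) hc₁ hR₁pos hστTR hc₁.le le_rfl hμ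
      (by rw [zero_mul, add_zero]) hfar
      (fun s hs => hYV s (hsub2 hs)) (fun s hs => hhighY s (hsub2 hs)) (fun s hs => hvortY s (hsub2 hs))
      hrad₂ hrate₂
    -- ### Grönwall on `[σ₁ + τ, TR]`: the radius grows at rate `c₁`
    have hfast2 : ∀ s ∈ Icc (σ₁ + τ) TR, ⟪Y s, selfSimilarTransport γ 0 V (Y s)⟫ ≤ -(c₁ * ‖Y s‖ ^ 2) := by
      intro s hs
      have := (hphase2 s hs).2
      rw [zero_mul, add_zero] at this
      linarith
    have hYV' : ∀ s ∈ Icc (σ₁ + τ) TR, HasDerivAt Y ((-1 : ℝ) • selfSimilarTransport γ 0 V (Y s)) s := by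
      intro s hs; rw [neg_one_smul]; exact hYV s (hsub2 hs)
    have hgron := BackwardEscape.norm_ge_mul_exp_of_fastInflow (γ := γ) (V := V) (Y := Y) (c₁ := c₁) hστTR hYV' hfast2
      TR (right_mem_Icc.2 hστTR)
    have hlingTR : ‖Y TR‖ ≤ 2 * R := hling TR (right_mem_Icc.2 hTR0)
    -- `‖Y (σ₁+τ)‖ · e^{c₁ (TR − σ₁ − τ)} > 2R` since `c₁ (TR − σ₁ − τ) ≥ log R + log 2 + c₁` and `‖Y (σ₁+τ)‖ ≥ Rs ≥ 1`
    have hSbig : Real.log R + Real.log 2 + c₁ ≤ c₁ * (TR - (σ₁ + τ)) := by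
      have h1 : c₁ * σ₁ ≤ c₁ * n₀ := mul_le_mul_of_nonneg_left hσ₁n₀ hc₁.le
      have h2 : c₁ * ((n₀ : ℝ) + τ + (Real.log R + Real.log 2) / c₁ + 1) ≤ c₁ * TR :=
        mul_le_mul_of_nonneg_left hTR_ge hc₁.le
      have h3 : c₁ * ((n₀ : ℝ) + τ + (Real.log R + Real.log 2) / c₁ + 1) =
          c₁ * n₀ + c₁ * τ + (Real.log R + Real.log 2) + c₁ := by
        field_simp
      have h4 : c₁ * (TR - (σ₁ + τ)) = c₁ * TR - c₁ * σ₁ - c₁ * τ := by ring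
      linarith only [h1, h2, h3, h4]
    have hRs_le : Rs ≤ ‖Y (σ₁ + τ)‖ := by have := hend1.1; rwa [hYσ₁] at this
    have hexp : 2 * R < ‖Y (σ₁ + τ)‖ * Real.exp (c₁ * (TR - (σ₁ + τ))) := by
      have h1 : Real.exp (Real.log R + Real.log 2 + c₁) ≤ Real.exp (c₁ * (TR - (σ₁ + τ))) := Real.exp_le_exp.2 hSbig
      have h2 : Real.exp (Real.log R + Real.log 2 + c₁) = 2 * R * Real.exp c₁ := by
        rw [Real.exp_add, Real.exp_add, Real.exp_log hRpos, Real.exp_log two_pos]; ring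
      have h3 : 1 < Real.exp c₁ := Real.one_lt_exp_iff.2 hc₁
      have h4 : 2 * R < 2 * R * Real.exp c₁ := by
        have : 0 < 2 * R := by linarith only [hRpos]
        nlinarith only [this, h3]
      calc 2 * R < 2 * R * Real.exp c₁ := h4
        _ = Real.exp (Real.log R + Real.log 2 + c₁) := h2.symm
        _ ≤ Real.exp (c₁ * (TR - (σ₁ + τ))) := h1
        _ = 1 * Real.exp (c₁ * (TR - (σ₁ + τ))) := (one_mul _).symm
        _ ≤ ‖Y (σ₁ + τ)‖ * Real.exp (c₁ * (TR - (σ₁ + τ))) :=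
          mul_le_mul_of_nonneg_right (le_trans hRs1 hRs_le) (Real.exp_nonneg _)
    exact lt_irrefl _ (lt_of_lt_of_le hexp (hgron.trans hlingTR))
  -- ### conclusion: measure comparison
  have hmono := measure_mono (μ := volume) hincl
  have hn₀' : volume (Sn n₀) ≤ volume (ball x₀ r) / 2 := hn₀
  have hle : volume (ball x₀ r ∩ {y | ∀ σ ∈ Icc 0 TR, ‖Φ' (-σ) y‖ ≤ 2 * R}) ≤ volume (ball x₀ r) / 2 :=
    hmono.trans hn₀'
  have hne : volume (ball x₀ r) / 2 ≠ ∞ := ENNReal.div_ne_top hvtop.ne (by norm_num)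
  have := ENNReal.toReal_mono hne hle
  rwa [ENNReal.toReal_div, ENNReal.toReal_ofNat] at this


end BandClock

end Summit.NavierStokesRegularity.NavierStokesRegularity.Theorems.PowerGaugeEulerLiouville

end
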